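import Summits.PneNP.PneNP.Theorems.ChebyshevTracialDesignWhiteningData
import Summits.PneNP.PneNP.Theorems.ChebyshevTracialDesignTightEigenDecay
import Summits.PneNP.PneNP.Theorems.ChebyshevTracialDesignTracialProfilePolynomial
import HarnessLib

/-!
# Cell pnp-psdrank, route `ChebyshevTracialDesign`: the WELL-CONDITIONED CELL — pairs of contraction fields whose means are bounded below
# spectrally (`X̄ ⪰ μI`, `Ȳ ⪰ νI`, `μν` above an explicit mode sum `≍ 1/n`) are VIRTUALLY NONNEGATIVE, at EVERY dimension `r`

Harmonic backbone of the crux `TracialDecayExp20` (stmt-PneNP-19878), brick 87b-II (prover g16; MEMO-19 §2(c), the kernel assembly announced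
there). Inputs, all landed: brick 45b `virtual_psd_mul_eq` (the virtual value of a matrix strategy in Hilbert–Schmidt tight modes `C_κ`,
re-weighted by `R_κ`, with `κ = 0` term the overlap), brick 45d `kernelEigen_tight_even_le` (`λ_{2κ} ≤ |PM|·N₁²·A_κ/C(n,t)`), brick 29
`kernelEigen_tight_even_nonneg`, brick 87 (`whitened_HSmode_sq_le`, `sum_sq_le_of_contraction_family`, `trace_dewhiten`,
`trace_whiten_overlap`), brick 87b-I (`…WhiteningData`: `exists_whitening`, `layerEnergy_le`, `layerData_conj`, `sum_powersetCard_eq_of_layers`),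
brick 20 (`tracial_value_truncation_explicit`).
* §4 **`virtualNonneg_of_wellConditioned`** — `n` even, `t = 2c'+1`, `2t ≤ n`, `D ≤ 2c'`; `X`, `Y` psd-contraction fields with
  `Σ_{|U|=t} X_U ⪰ μ·C(n,t)·I`, `Σ_M Y_M ⪰ ν·|PM|·I` (`μ, ν > 0`: every direction of `ℝ^r` has density `≥ μ`, resp. `≥ ν`) and the MODE CONDITION
  `Σ_{κ=1}^{D/2} R_κ·√A_κ ≤ √(μν)` (`R_κ = Π_{i<κ}(t−2i)(n−t−2i)/((t−1−2i)(n−t−1−2i))`, `A_κ = Π_{i<κ}(2i+1)/(n−2i)`; `Σ_κ R_κ√A_κ ≍ n^{−1/2}`,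
  so the condition reads `μν ≳ 1/n`): for EVERY entrywise harmonic layer data `p` of `X`, the virtual value
  `Σ_M Σ_{|A|≤D} tr(Q_A Y_M)·knapsackMoment(|M|, t/2, |M[A]|)` is `≥ 0`. PROOF: whiten both sides (`A_U = S'X_US'ᵀ`, `B_M = T'Y_MT'ᵀ`,
  `C = SᵀT`, `tr(CᵀC) = tr(ΣX·ΣY)`), rewrite each mode as `C_κ = Σ_{U,M} 1[cc=1]·tr(Q̃_U C B_M Cᵀ)` (`trace_dewhiten`), bound it by brick 87
  with `α = (μ·C(n,t))⁻¹` (87b-I `layerEnergy_le` + 87 §3), `β = (ν·|PM|)⁻¹`, `λ_{2κ} ≤ |PM|N₁²A_κ/C(n,t)`: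
  `|C_κ| ≤ (N₁/C(n,t))·√(A_κ/(μν))·tr(ΣX·ΣY)`; the `κ = 0` term is `(N₁/C(n,t))·tr(ΣX·ΣY)` (45b `layerCorr_zero_weighted` + the slice mean
  of a ladder sum); hence `V·N₁ ≥ (N₁/C(n,t))·tr(ΣX·ΣY)·(1 − Σ_κ R_κ√A_κ/√(μν)) ≥ 0`.
* §5 **`value_le_tail_of_wellConditioned`** — hence, with brick 20's truncation theorem, for every exact design of degree `D ≤ 2c'` on the
  `t`-cuts such a pair has design value `≤ r·(Σ_c|w_c|)·√(Π_{i≤D/2}(2i+1)/(n−2i))` (the deep tail only): the crux's kind of bound at EVERY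
  dimension, with NO tightness, spreadness, commutativity or low-degree hypothesis — the first r-UNIFORM cell of the programme whose hypothesis
  is analytic and basis-free (MEMO-19 §2). Brick 45b's docstring named the κ = 0 overlap as 'the ONE place where the r = 1 argument does not
  lift to psd'; whitening (brick 87) is the lift. The `r = 1` shadow is the trivial dense regime `μν ≳ 1/n`; what remains OPEN of the crux is
  the directionally SPARSE regime (a direction in which `X̄` or `Ȳ` has density `≲ n^{−1/2}`), the analogue of the sparse sets that
  Kupavskii–Zakharov pins and Keevash–Lifshitz globalness handle at `r = 1`.
[cite: BrouwerHaemers2012, Thm. 4.9.1 (PDF p. 93)] [cite: MacWilliamsSloane1977, Ch. 21 §6 Thm. 10 (PDF p. 516)] [cite: Grigoriev2001, Lemma 1.4 (PDF p. 8)]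
[cite: GriblingDelaatLaurent2019, §5] [cite: Rothvoss2017, §2 (PDF p. 6)] [cite: CoppersmithRivlin1992, Thm. (p. 970)]
Stature: support/instrument (no defs, kernel lane; an UNCONDITIONAL theorem on a sub-class of strategies). WHAT THIS IS NOT: nothing on the
sparse regime, not the crux, nothing on psd rank of P_PM(K_n), no P-vs-NP content. Supports stmt-PneNP-19878.
-/

set_option linter.dupNamespace false -- `Summit.PneNP.PneNP.…`: summit = sub-problem (D-0017)

noncomputable section

namespace Summit.PneNP.PneNP.Theorems.ChebyshevTracialDesignWellConditionedCell

open Finset Matrix Literature.Barriers.PneNP Literature.Combinatorics.Optimization Literature.Computability.Complexity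
open Literature.Combinatorics.AssociationSchemes Literature.Combinatorics.AssociationSchemes.JohnsonHarmonics
open Literature.Combinatorics.AssociationSchemes.JohnsonSpectrum
open Summit.PneNP.PneNP.Theorems.ChebyshevTracialDesignCommutative (posSemidef_conj one_sub_conj conj_mul_conj trace_conj)
open Summit.PneNP.PneNP.Theorems.ChebyshevTracialDesignWhitenedModeBound
open Summit.PneNP.PneNP.Theorems.ChebyshevTracialDesignWhiteningData
open Summit.PneNP.PneNP.Theorems.ChebyshevTracialDesignHSModeParseval (kernelEigen_tight_even_le)
open Summit.PneNP.PneNP.Theorems.ChebyshevTracialDesignTightEigenDecay (kernelEigen_tight_even_nonneg)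
open Summit.PneNP.PneNP.Theorems.ChebyshevTracialDesignTightFreeSpectral (exists_tightGram_classFunction)
open Summit.PneNP.PneNP.Theorems.ChebyshevTracialDesignVirtualBimodePsd (virtual_psd_mul_eq layerCorr_zero_weighted)
open Summit.PneNP.PneNP.Theorems.ChebyshevTracialDesignTracialProfilePolynomial (sum_oddSet_card_eq tracial_value_truncation_explicit)
open Summit.PneNP.PneNP.Theorems.ChebyshevTracialDesignProfilePolynomial (card_pmatch_pos)

variable {n r : ℕ}

/-! ### §4 Virtual nonnegativity of well-conditioned pairs, at every dimension -/

/-- **WELL-CONDITIONED PAIRS ARE VIRTUALLY NONNEGATIVE, AT EVERY DIMENSION `r`.** `n` even, `t = 2c'+1`, `2t ≤ n`, `D ≤ 2c'`; `X`, `Y`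
families of psd contractions on the odd cuts / perfect matchings with `Σ_{|U|=t} X_U ⪰ μ·C(n,t)·I`, `Σ_M Y_M ⪰ ν·|PM|·I` (`μ, ν > 0`: every
direction has density at least `μ`, resp. `ν`), and the mode condition `Σ_{κ=1}^{D/2} R_κ·√A_κ ≤ √(μν)`. Then for every entrywise harmonic
layer data `p` of `X` on the `t`-cuts, the virtual value `Σ_M Σ_{|A|≤D} tr(Q_A Y_M)·knapsackMoment(|M|, t/2, |M[A]|)` is nonnegative.
Proof: whitening (§1) + the whitened HS-mode bound (brick 87) + operator-norm layer energies (§2) against the `κ = 0` overlap term of brick 45b.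
[cite: Grigoriev2001, Lemma 1.4 (PDF p. 8)] [cite: BrouwerHaemers2012, Thm. 4.9.1 (PDF p. 93)] [cite: MacWilliamsSloane1977, Ch. 21 §6 Thm. 10 (PDF p. 516)]
[cite: GriblingDelaatLaurent2019, §5] -/
theorem virtualNonneg_of_wellConditioned {c' D : ℕ} (hn : Even n) (ht : 2 * (2 * c' + 1) ≤ n) (hD : D ≤ 2 * c')
    (X : OddSet n → Matrix (Fin r) (Fin r) ℝ) (Y : PMatch n → Matrix (Fin r) (Fin r) ℝ)
    (hX : ∀ U, (X U).PosSemidef ∧ (1 - X U).PosSemidef) (hY : ∀ M, (Y M).PosSemidef ∧ (1 - Y M).PosSemidef)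
    {μ ν : ℝ} (hμ : 0 < μ) (hν : 0 < ν)
    (hXbar : ((∑ U : OddSet n, if U.1.card = 2 * c' + 1 then X U else 0) -
      (μ * (n.choose (2 * c' + 1) : ℝ)) • (1 : Matrix (Fin r) (Fin r) ℝ)).PosSemidef)
    (hYbar : ((∑ M, Y M) - (ν * (Fintype.card (PMatch n) : ℝ)) • (1 : Matrix (Fin r) (Fin r) ℝ)).PosSemidef)
    (hcond : ∑ κ ∈ Icc 1 (D / 2),
        (∏ i ∈ range κ, (((2 * c' + 1 : ℝ) - 2 * i) * ((n : ℝ) - 2 * c' - 1 - 2 * i) /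
            (((2 * c' : ℝ) - 2 * i) * ((n : ℝ) - 2 * c' - 2 - 2 * i)))) *
          Real.sqrt (∏ i ∈ range κ, ((2 * i + 1 : ℝ) / ((n : ℝ) - 2 * i))) ≤ Real.sqrt (μ * ν))
    (p : Fin r × Fin r → ℕ → Finset (Fin n) → ℝ) (hp : ∀ ab j, IsHarmonic j (p ab j))
    (hpdec : ∀ ab (U : OddSet n), U.1.card = 2 * c' + 1 →
      X U ab.1 ab.2 = (∑ j ∈ range (2 * c' + 1 + 1), up^[2 * c' + 1 - j] (p ab j)) U.1) :
    0 ≤ ∑ M : PMatch n, ∑ A : {A : Finset (Fin n) // A.card ≤ D},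
        (Matrix.of (fun a b : Fin r =>
          (∑ j ∈ range (2 * c' + 1 + 1), ((2 * c' + 1 - j).factorial : ℝ) • (if D < j then 0 else p (a, b) j)) A.1) * Y M).trace *
          knapsackMoment M.1.card (((2 * c' + 1 : ℕ) : ℝ) / 2) (M.1.filter fun e => ∃ a ∈ A.1, a ∈ e).card := by
  -- constants
  have hPm : (0 : ℝ) < Fintype.card (PMatch n) := by exact_mod_cast card_pmatch_pos hn
  have hCn : (0 : ℝ) < (n.choose (2 * c' + 1) : ℝ) := by exact_mod_cast Nat.choose_pos (by omega)
  set Pm : ℝ := (Fintype.card (PMatch n) : ℝ) with hPmdef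
  set Cn : ℝ := (n.choose (2 * c' + 1) : ℝ) with hCndef
  set N₁ : ℝ := ((((n / 2).choose (1 + c') * (1 + c').choose c' * 2 ^ 1 : ℕ) : ℝ)) with hN₁
  have hN₁pos : 0 < N₁ := by
    rw [hN₁]
    have h1 : 0 < (n / 2).choose (1 + c') := Nat.choose_pos (by omega)
    have h2 : 0 < (1 + c').choose c' := Nat.choose_pos (by omega)
    exact_mod_cast Nat.mul_pos (Nat.mul_pos h1 h2) (by norm_num)
  set k : Finset (Fin n) → PMatch n → ℝ := fun U M => if (U.filter fun x => M.2.partner x ∉ U).card = 1 then (1 : ℝ) else 0 with hk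
  set Cm : ℕ → ℝ := fun κ => ∑ ab : Fin r × Fin r, ∑ M : PMatch n, Y M ab.2 ab.1 * ∑ U ∈ univ.powersetCard (2 * c' + 1),
    (up^[2 * c' + 1 - 2 * κ] (p ab (2 * κ))) U * k U M with hCm
  set R : ℕ → ℝ := fun κ => ∏ i ∈ range κ, (((2 * c' + 1 : ℝ) - 2 * i) * ((n : ℝ) - 2 * c' - 1 - 2 * i) /
    (((2 * c' : ℝ) - 2 * i) * ((n : ℝ) - 2 * c' - 2 - 2 * i))) with hR
  set Aκ : ℕ → ℝ := fun κ => ∏ i ∈ range κ, ((2 * i + 1 : ℝ) / ((n : ℝ) - 2 * i)) with hAκ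
  set V : ℝ := ∑ M : PMatch n, ∑ A : {A : Finset (Fin n) // A.card ≤ D},
        (Matrix.of (fun a b : Fin r =>
          (∑ j ∈ range (2 * c' + 1 + 1), ((2 * c' + 1 - j).factorial : ℝ) • (if D < j then 0 else p (a, b) j)) A.1) * Y M).trace *
          knapsackMoment M.1.card (((2 * c' + 1 : ℕ) : ℝ) / 2) (M.1.filter fun e => ∃ a ∈ A.1, a ∈ e).card with hV
  -- brick 45b: the virtual value in modes
  have h45 : V * N₁ = ∑ κ ∈ range (D / 2 + 1), R κ * Cm κ := virtual_psd_mul_eq hn ht hD p hp Y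
  -- the cut side as a function on `t`-subsets
  set SX : Matrix (Fin r) (Fin r) ℝ := ∑ U : OddSet n, if U.1.card = 2 * c' + 1 then X U else 0 with hSX
  set SY : Matrix (Fin r) (Fin r) ℝ := ∑ M, Y M with hSY
  set Xf : Finset (Fin n) → Matrix (Fin r) (Fin r) ℝ := fun U =>
    if h : U.card = 2 * c' + 1 then X ⟨U, by rw [h]; exact odd_two_mul_add_one c'⟩ else 0 with hXf
  have hXf_eq : ∀ U (hU : U.card = 2 * c' + 1), Xf U = X ⟨U, by rw [hU]; exact odd_two_mul_add_one c'⟩ := fun U hU => by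
    rw [hXf]; exact dif_pos hU
  have hXf_psd : ∀ U ∈ univ.powersetCard (2 * c' + 1), (Xf U).PosSemidef ∧ (1 - Xf U).PosSemidef := fun U hU => by
    rw [hXf_eq U (mem_powersetCard.1 hU).2]; exact hX _
  have hXfdec : ∀ ab, ∀ U ∈ univ.powersetCard (2 * c' + 1),
      Xf U ab.1 ab.2 = (∑ j ∈ range (2 * c' + 1 + 1), up^[2 * c' + 1 - j] (p ab j)) U := fun ab U hU => by
    rw [hXf_eq U (mem_powersetCard.1 hU).2]; exact hpdec ab _ (mem_powersetCard.1 hU).2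
  have hSX_eq : SX = ∑ U ∈ univ.powersetCard (2 * c' + 1), Xf U := by
    ext a b
    rw [hSX, Matrix.sum_apply, Matrix.sum_apply]
    have h := sum_oddSet_card_eq (n := n) (odd_two_mul_add_one c') (fun U => Xf U a b)
    rw [← h]
    refine sum_congr rfl fun U _ => ?_
    split_ifs with hU
    · rw [hXf_eq U.1 hU]
    · rfl
  -- whitening
  have hSXherm : SX.IsHermitian := by
    rw [hSX_eq]
    unfold IsHermitian
    rw [conjTranspose_sum]
    exact sum_congr rfl fun U hU => (hXf_psd U hU).1.1
  have hSYherm : SY.IsHermitian := by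
    rw [hSY]
    unfold IsHermitian
    rw [conjTranspose_sum]
    exact sum_congr rfl fun M _ => (hY M).1.1
  have hXbar' : (SX - (μ * Cn) • (1 : Matrix (Fin r) (Fin r) ℝ)).PosSemidef := hXbar
  obtain ⟨S, S', hSS', hSSt, hS'X, hS'le⟩ := exists_whitening hSXherm (mul_pos hμ hCn) hXbar'
  obtain ⟨T, T', hTT', hTTt, hT'Y, hT'le⟩ := exists_whitening hSYherm (mul_pos hν hPm) hYbar
  set C : Matrix (Fin r) (Fin r) ℝ := Sᵀ * T with hCdef
  have htrC : (Cᵀ * C).trace = (SX * SY).trace := by rw [hCdef, trace_whiten_overlap, hSSt, hTTt]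
  have htr0 : 0 ≤ (Cᵀ * C).trace := by
    rw [← sum_sq_eq_trace_transpose_mul]; exact sum_nonneg fun il _ => sq_nonneg _
  -- whitened sides
  set Aw : Finset (Fin n) → Matrix (Fin r) (Fin r) ℝ := fun U => S' * Xf U * S'ᵀ with hAw
  set Bw : PMatch n → Matrix (Fin r) (Fin r) ℝ := fun M => T' * Y M * T'ᵀ with hBw
  set q : Fin r × Fin r → ℕ → Finset (Fin n) → ℝ := fun ab j => ∑ c, ∑ d, (S' ab.1 c * S' ab.2 d) • p (c, d) j with hq
  have hqh : ∀ ab j, IsHarmonic j (q ab j) := fun ab j =>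
    IsHarmonic.sum _ fun c _ => IsHarmonic.sum _ fun d _ => (hp (c, d) j).smul _
  have hAwdec : ∀ ab, ∀ U ∈ univ.powersetCard (2 * c' + 1),
      Aw U ab.1 ab.2 = (∑ j ∈ range (2 * c' + 1 + 1), up^[2 * c' + 1 - j] (q ab j)) U :=
    layerData_conj (univ.powersetCard (2 * c' + 1)) S' Xf p hXfdec
  -- energy of the whitened cut side: `Σ Aw² ⪯ (μ Cn)⁻¹ I`
  have hAw_sum : ∑ U ∈ univ.powersetCard (2 * c' + 1), Aw U = 1 := by
    rw [← hS'X, hSX_eq, Finset.mul_sum, Finset.sum_mul]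
  have hAwE : ((μ * Cn)⁻¹ • (1 : Matrix (Fin r) (Fin r) ℝ) - ∑ U ∈ univ.powersetCard (2 * c' + 1), (Aw U)ᵀ * Aw U).PosSemidef := by
    have h := sum_sq_le_of_contraction_family (univ.powersetCard (2 * c' + 1)) Aw
      (fun U hU => posSemidef_conj (hXf_psd U hU).1 S') (K := (μ * Cn)⁻¹) (N := 1) (inv_nonneg.2 (mul_pos hμ hCn).le)
      (fun U hU => by
        have h1 : ((μ * Cn)⁻¹ • (1 : Matrix (Fin r) (Fin r) ℝ) - S' * Xf U * S'ᵀ) =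
            ((μ * Cn)⁻¹ • (1 : Matrix (Fin r) (Fin r) ℝ) - S' * S'ᵀ) + S' * (1 - Xf U) * S'ᵀ := by
          rw [Matrix.mul_sub, Matrix.sub_mul, Matrix.mul_one]; abel
        rw [hAw]; dsimp only; rw [h1]
        exact hS'le.add (posSemidef_conj (hXf_psd U hU).2 S'))
      (by rw [hAw_sum, one_smul, sub_self]; exact PosSemidef.zero)
    rwa [mul_one] at h
  -- energy of the whitened matching side: `Σ Bw² ⪯ (ν Pm)⁻¹ I`
  have hBw_sum : ∑ M, Bw M = 1 := by rw [← hT'Y, hSY, Finset.mul_sum, Finset.sum_mul]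
  have hBwE : ((ν * Pm)⁻¹ • (1 : Matrix (Fin r) (Fin r) ℝ) - ∑ M, (Bw M)ᵀ * Bw M).PosSemidef := by
    have h := sum_sq_le_of_contraction_family (univ : Finset (PMatch n)) Bw
      (fun M _ => posSemidef_conj (hY M).1 T') (K := (ν * Pm)⁻¹) (N := 1) (inv_nonneg.2 (mul_pos hν hPm).le)
      (fun M _ => by
        have h1 : ((ν * Pm)⁻¹ • (1 : Matrix (Fin r) (Fin r) ℝ) - T' * Y M * T'ᵀ) =
            ((ν * Pm)⁻¹ • (1 : Matrix (Fin r) (Fin r) ℝ) - T' * T'ᵀ) + T' * (1 - Y M) * T'ᵀ := by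
          rw [Matrix.mul_sub, Matrix.sub_mul, Matrix.mul_one]; abel
        rw [hBw]; dsimp only; rw [h1]
        exact hT'le.add (posSemidef_conj (hY M).2 T'))
      (by rw [hBw_sum, one_smul, sub_self]; exact PosSemidef.zero)
    rwa [mul_one] at h
  -- the tight Gram class function
  obtain ⟨κ₁, hA1⟩ := exists_tightGram_classFunction (n := n) (odd_two_mul_add_one c')
  -- each mode in whitened form, and its bound
  have hmode : ∀ κ, κ ≤ c' → |Cm κ| ≤ (N₁ / Cn) * (Real.sqrt (Aκ κ) / Real.sqrt (μ * ν)) * (SX * SY).trace := by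
    intro κ hκ
    have hjt : 2 * κ ≤ 2 * c' + 1 := by omega
    -- rewrite the mode
    set Qt : Finset (Fin n) → Matrix (Fin r) (Fin r) ℝ := fun U => Matrix.of fun a b => (up^[2 * c' + 1 - 2 * κ] (q (a, b) (2 * κ))) U
      with hQt
    set Pt : Finset (Fin n) → Matrix (Fin r) (Fin r) ℝ := fun U => Matrix.of fun a b => (up^[2 * c' + 1 - 2 * κ] (p (a, b) (2 * κ))) U
      with hPt
    have hQP : ∀ U, Qt U = S' * Pt U * S'ᵀ := fun U => by
      rw [hPt, hQt]; dsimp only; rw [conj_layerMatrix S' (fun a b => p (a, b) (2 * κ)) U]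
    have hSQS : ∀ U, S * Qt U * Sᵀ = Pt U := fun U => by
      rw [hQP U]
      calc S * (S' * Pt U * S'ᵀ) * Sᵀ = (S * S') * Pt U * (S * S')ᵀ := by rw [transpose_mul]; simp only [Matrix.mul_assoc]
        _ = Pt U := by rw [hSS', transpose_one, Matrix.one_mul, Matrix.mul_one]
    have hTBT : ∀ M, T * Bw M * Tᵀ = Y M := fun M => by
      rw [hBw]; dsimp only
      calc T * (T' * Y M * T'ᵀ) * Tᵀ = (T * T') * Y M * (T * T')ᵀ := by rw [transpose_mul]; simp only [Matrix.mul_assoc]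
        _ = Y M := by rw [hTT', transpose_one, Matrix.one_mul, Matrix.mul_one]
    have hCm_eq : Cm κ = ∑ U ∈ univ.powersetCard (2 * c' + 1), ∑ M : PMatch n, k U M * (Qt U * C * Bw M * Cᵀ).trace := by
      have e1 : ∀ U (M : PMatch n), (Qt U * C * Bw M * Cᵀ).trace = (Pt U * Y M).trace := fun U M => by
        rw [← hSQS U, ← hTBT M, hCdef, trace_dewhiten]
      simp_rw [e1, Summit.PneNP.PneNP.Theorems.ChebyshevTracialDesignTracialProfilePolynomial.trace_mul_eq_sum_pairs, mul_sum]
      rw [hCm]; dsimp only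
      calc ∑ ab : Fin r × Fin r, ∑ M : PMatch n, Y M ab.2 ab.1 * ∑ U ∈ univ.powersetCard (2 * c' + 1),
            (up^[2 * c' + 1 - 2 * κ] (p ab (2 * κ))) U * k U M
          = ∑ ab : Fin r × Fin r, ∑ M : PMatch n, ∑ U ∈ univ.powersetCard (2 * c' + 1),
              k U M * (Pt U ab.1 ab.2 * Y M ab.2 ab.1) := by
            refine sum_congr rfl fun ab _ => sum_congr rfl fun M _ => ?_
            rw [mul_sum]
            refine sum_congr rfl fun U _ => ?_
            rw [hPt]; dsimp only; rw [Matrix.of_apply]; ring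
        _ = ∑ ab : Fin r × Fin r, ∑ U ∈ univ.powersetCard (2 * c' + 1), ∑ M : PMatch n,
              k U M * (Pt U ab.1 ab.2 * Y M ab.2 ab.1) := sum_congr rfl fun ab _ => sum_comm
        _ = ∑ U ∈ univ.powersetCard (2 * c' + 1), ∑ ab : Fin r × Fin r, ∑ M : PMatch n,
              k U M * (Pt U ab.1 ab.2 * Y M ab.2 ab.1) := sum_comm
        _ = _ := sum_congr rfl fun U _ => sum_comm
    -- the whitened HS-mode bound
    have hΛ := kernelEigen_tight_even_nonneg hn ht hκ κ₁ hA1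
    have hlayer := layerEnergy_le hjt q hqh Aw hAwdec hAwE
    have hsq := whitened_HSmode_sq_le hjt (fun ab => q ab (2 * κ)) (fun ab => hqh ab (2 * κ)) κ₁ hA1 hΛ Bw C hlayer hBwE
    rw [← hCm_eq] at hsq
    -- numeric bound on `λ α β`
    have hlam := kernelEigen_tight_even_le hn ht hκ κ₁ hA1
    have hAκ0 : 0 ≤ Aκ κ := by
      rw [hAκ]
      refine prod_nonneg fun i hi => ?_
      have hi' := mem_range.1 hi
      have : (2 * i : ℝ) + 2 ≤ n := by exact_mod_cast (show 2 * i + 2 ≤ n by omega)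
      exact div_nonneg (by positivity) (by linarith)
    have hprod : kernelEigen n (2 * c' + 1) (2 * κ) κ₁ * (μ * Cn)⁻¹ * (ν * Pm)⁻¹ ≤ (N₁ / Cn) ^ 2 * (Aκ κ / (μ * ν)) := by
      have h1 : kernelEigen n (2 * c' + 1) (2 * κ) κ₁ * (μ * Cn)⁻¹ * (ν * Pm)⁻¹ ≤
          (Pm * N₁ ^ 2 / Cn * Aκ κ) * (μ * Cn)⁻¹ * (ν * Pm)⁻¹ :=
        mul_le_mul_of_nonneg_right (mul_le_mul_of_nonneg_right hlam (inv_nonneg.2 (mul_pos hμ hCn).le))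
          (inv_nonneg.2 (mul_pos hν hPm).le)
      refine h1.trans_eq ?_
      field_simp
    have habs : |Cm κ| ≤ Real.sqrt ((N₁ / Cn) ^ 2 * (Aκ κ / (μ * ν))) * (Cᵀ * C).trace := by
      have h1 : (Cm κ) ^ 2 ≤ ((N₁ / Cn) ^ 2 * (Aκ κ / (μ * ν))) * (Cᵀ * C).trace ^ 2 :=
        hsq.trans (mul_le_mul_of_nonneg_right hprod (sq_nonneg _))
      have h2 := Real.abs_le_sqrt h1
      rwa [Real.sqrt_mul' _ (sq_nonneg _), Real.sqrt_sq htr0] at h2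
    rw [Real.sqrt_mul (sq_nonneg _), Real.sqrt_sq (div_nonneg hN₁pos.le hCn.le), Real.sqrt_div' _ (mul_pos hμ hν).le, htrC] at habs
    exact habs
  -- the overlap term `κ = 0`
  have hCm0 : Cm 0 = (N₁ / Cn) * (SX * SY).trace := by
    have e1 : ∀ ab : Fin r × Fin r, ∑ M : PMatch n, Y M ab.2 ab.1 * ∑ U ∈ univ.powersetCard (2 * c' + 1),
        (up^[2 * c' + 1 - 2 * 0] (p ab (2 * 0))) U * k U M =
        (((2 * c' + 1).factorial : ℝ) * p ab (2 * 0) ∅ * N₁) * ∑ M : PMatch n, Y M ab.2 ab.1 := fun ab =>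
      layerCorr_zero_weighted (c' := c') (by simpa using hp ab (2 * 0)) (fun M => Y M ab.2 ab.1)
    have e2 : ∀ ab : Fin r × Fin r, ((2 * c' + 1).factorial : ℝ) * p ab (2 * 0) ∅ = SX ab.1 ab.2 / Cn := by
      intro ab
      rw [Nat.mul_zero, eq_div_iff hCn.ne', hSX_eq, Matrix.sum_apply, sum_powersetCard_eq_of_layers Xf p hp hXfdec ab]
      ring
    have e3 : ∀ ab : Fin r × Fin r, ∑ M : PMatch n, Y M ab.2 ab.1 = SY ab.2 ab.1 := fun ab => by rw [hSY, Matrix.sum_apply]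
    rw [hCm]; dsimp only
    simp_rw [e1, e2, e3]
    rw [Summit.PneNP.PneNP.Theorems.ChebyshevTracialDesignTracialProfilePolynomial.trace_mul_eq_sum_pairs, mul_sum]
    exact sum_congr rfl fun ab _ => by ring
  -- assembly
  have htrXY : 0 ≤ (SX * SY).trace := by rw [← htrC]; exact htr0
  have hmain : 0 ≤ V * N₁ := by
    rw [h45, sum_range_succ_eq_add_Icc]
    have hR0 : R 0 = 1 := by rw [hR]; exact prod_range_zero _
    rw [hR0, one_mul, hCm0]
    -- the modes `κ ≥ 1`
    have hsum : |∑ κ ∈ Icc 1 (D / 2), R κ * Cm κ| ≤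
        (N₁ / Cn) * (SX * SY).trace * ((∑ κ ∈ Icc 1 (D / 2), R κ * Real.sqrt (Aκ κ)) / Real.sqrt (μ * ν)) := by
      calc |∑ κ ∈ Icc 1 (D / 2), R κ * Cm κ| ≤ ∑ κ ∈ Icc 1 (D / 2), |R κ * Cm κ| := abs_sum_le_sum_abs _ _
        _ ≤ ∑ κ ∈ Icc 1 (D / 2), R κ * ((N₁ / Cn) * (Real.sqrt (Aκ κ) / Real.sqrt (μ * ν)) * (SX * SY).trace) := by
            refine sum_le_sum fun κ hκ => ?_
            have hκc : κ ≤ c' := by have := (mem_Icc.1 hκ).2; omega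
            rw [abs_mul, abs_of_nonneg (layerRatio_nonneg ht hκc)]
            exact mul_le_mul_of_nonneg_left (hmode κ hκc) (layerRatio_nonneg ht hκc)
        _ = ∑ κ ∈ Icc 1 (D / 2), ((N₁ / Cn) * (SX * SY).trace) * (R κ * Real.sqrt (Aκ κ) / Real.sqrt (μ * ν)) :=
            sum_congr rfl fun κ _ => by ring
        _ = (N₁ / Cn) * (SX * SY).trace * ((∑ κ ∈ Icc 1 (D / 2), R κ * Real.sqrt (Aκ κ)) / Real.sqrt (μ * ν)) := by
            rw [← Finset.mul_sum, Finset.sum_div]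
    have hfrac : (∑ κ ∈ Icc 1 (D / 2), R κ * Real.sqrt (Aκ κ)) / Real.sqrt (μ * ν) ≤ 1 := by
      rw [div_le_one (Real.sqrt_pos.2 (mul_pos hμ hν))]
      exact hcond
    have hpos : 0 ≤ (N₁ / Cn) * (SX * SY).trace := mul_nonneg (div_nonneg hN₁pos.le hCn.le) htrXY
    have h1 := (abs_le.1 hsum).1
    nlinarith [mul_le_mul_of_nonneg_left hfrac hpos]
  -- divide by `N₁ > 0`
  exact le_of_mul_le_mul_right (by rwa [zero_mul]) hN₁pos

/-! ### §5 The design value of a well-conditioned pair is at most the deep tail, at every dimension -/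

/-- **THE WELL-CONDITIONED CELL OF THE CRUX, r-UNIFORM.** For `n` even, an exact design `(n, t = 2c'+1, T, D ≤ 2c', B, C, w)`, and every pair
of psd-contraction families `X` (odd cuts), `Y` (perfect matchings) of ANY dimension `r` with `Σ_{|U|=t} X_U ⪰ μ·C(n,t)·I`,
`Σ_M Y_M ⪰ ν·|PM|·I` (`μ, ν > 0`) and `Σ_{κ=1}^{D/2} R_κ √A_κ ≤ √(μν)`: the design value is at most brick 20's deep tail,
`Σ_{U,M} W(U,M)·tr(X_U Y_M) ≤ r·(Σ_c|w_c|)·√(Π_{i ≤ D/2}(2i+1)/(n−2i))` — no tightness, spreadness, commutativity or low-degree hypothesis.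
[cite: Rothvoss2017, §2 (PDF p. 6)] [cite: Grigoriev2001, Lemma 1.4 (PDF p. 8)] [cite: GriblingDelaatLaurent2019, §5]
[cite: CoppersmithRivlin1992, Thm. (p. 970)] -/
theorem value_le_tail_of_wellConditioned {c' T D : ℕ} {Bv : ℝ} {C : Finset ℕ} {w : ℕ → ℝ} (hn : Even n)
    (hdes : IsExactDesign n (2 * c' + 1) T D Bv C w) (hD : D ≤ 2 * c')
    (X : OddSet n → Matrix (Fin r) (Fin r) ℝ) (Y : PMatch n → Matrix (Fin r) (Fin r) ℝ)
    (hX : ∀ U, (X U).PosSemidef ∧ (1 - X U).PosSemidef) (hY : ∀ M, (Y M).PosSemidef ∧ (1 - Y M).PosSemidef)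
    {μ ν : ℝ} (hμ : 0 < μ) (hν : 0 < ν)
    (hXbar : ((∑ U : OddSet n, if U.1.card = 2 * c' + 1 then X U else 0) -
      (μ * (n.choose (2 * c' + 1) : ℝ)) • (1 : Matrix (Fin r) (Fin r) ℝ)).PosSemidef)
    (hYbar : ((∑ M, Y M) - (ν * (Fintype.card (PMatch n) : ℝ)) • (1 : Matrix (Fin r) (Fin r) ℝ)).PosSemidef)
    (hcond : ∑ κ ∈ Icc 1 (D / 2),
        (∏ i ∈ range κ, (((2 * c' + 1 : ℝ) - 2 * i) * ((n : ℝ) - 2 * c' - 1 - 2 * i) /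
            (((2 * c' : ℝ) - 2 * i) * ((n : ℝ) - 2 * c' - 2 - 2 * i)))) *
          Real.sqrt (∏ i ∈ range κ, ((2 * i + 1 : ℝ) / ((n : ℝ) - 2 * i))) ≤ Real.sqrt (μ * ν)) :
    ∑ U : OddSet n, ∑ M : PMatch n, levelWeight n (2 * c' + 1) C w U M * (X U * Y M).trace ≤
      (r : ℝ) * ((∑ c ∈ C, |w c|) * Real.sqrt (∏ i ∈ range (D / 2 + 1), ((2 * i + 1 : ℝ) / ((n : ℝ) - 2 * i)))) := by
  have ht : 2 * (2 * c' + 1) ≤ n := by have := hdes.2.1; omega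
  have hPm : (0 : ℝ) < Fintype.card (PMatch n) := by exact_mod_cast card_pmatch_pos hn
  have hCn : (0 : ℝ) < (n.choose (2 * c' + 1) : ℝ) := by exact_mod_cast Nat.choose_pos (by omega)
  obtain ⟨p, hp, hpdec, habs⟩ := tracial_value_truncation_explicit hn hdes hD X Y
  have hV := virtualNonneg_of_wellConditioned hn ht hD X Y hX hY hμ hν hXbar hYbar hcond p hp hpdec
  have h1 := (abs_le.1 habs).2
  have hPD : 0 ≤ ∏ i ∈ range (D / 2 + 1), ((2 * i + 1 : ℝ) / ((n : ℝ) - 2 * i)) := by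
    refine prod_nonneg fun i hi => ?_
    have hi' := mem_range.1 hi
    have : (2 * i : ℝ) + 2 ≤ n := by exact_mod_cast (show 2 * i + 2 ≤ n by omega)
    exact div_nonneg (by positivity) (by linarith)
  have htail := Summit.PneNP.PneNP.Theorems.ChebyshevTracialDesignTracialProfilePolynomial.sqrt_tail_le_of_le hPD hCn hPm
    (Nat.cast_nonneg r) (sum_nonneg fun M _ => sum_nonneg fun a _ => sum_nonneg fun b _ => sq_nonneg _)
    (Summit.PneNP.PneNP.Theorems.ChebyshevTracialDesignTracialProfilePolynomial.sum_frobenius_cuts_le hdes.1 hX)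
    (Summit.PneNP.PneNP.Theorems.ChebyshevTracialDesignTracialProfilePolynomial.sum_frobenius_matchings_le hY)
  have hBv : 0 ≤ ∑ c ∈ C, |w c| := sum_nonneg fun c _ => abs_nonneg _
  have h2 := mul_le_mul_of_nonneg_left htail hBv
  have h3 : 0 ≤ (Fintype.card (PMatch n) : ℝ)⁻¹ * _ := mul_nonneg (inv_nonneg.2 hPm.le) hV
  nlinarith [h1, h2, h3]
end Summit.PneNP.PneNP.Theorems.ChebyshevTracialDesignWellConditionedCell

end
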